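import Summits.QuantumAdvantage.QuantumAdvantage.Theorems.SosSandwichPseudoBoundedAAChebyshevFamily
import Literature.Computability.QuantumComplexity.InfluenceBounds
import Literature.Computability.QuantumComplexity.AaronsonAmbainisL1Form
import Mathlib.RingTheory.Polynomial.Chebyshev
import Mathlib.Analysis.SpecialFunctions.Trigonometric.Chebyshev.RootsExtrema
import Mathlib.Analysis.SpecialFunctions.Trigonometric.Inverse
import Mathlib.Analysis.Calculus.MeanValue
import Mathlib.Analysis.Calculus.Deriv.Polynomial

/-!
# Route `SosSandwich`, crux `PseudoBoundedAA` (stmt-QuantumAdvantage-15237) — the Chebyshev family has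
ALL INFLUENCES `O(1/N + k²/N²)`: the influence half of the `T`-side exponent calibration

Helper (`--supports stmt-QuantumAdvantage-15237`), conjecture-free, no named facts; continues
`SosSandwichPseudoBoundedAAChebyshevFamily.lean` (`p_k = T_k(ȳ)² ∈ K_k`, `ȳ = (1/N)Σᵢ(1 − 2xᵢ)`,
exact variance identity).

MAIN THEOREM (`influence_chebyshevT_sq_le`): for `N ≥ 20`, every `k` and EVERY variable `i`,
  `Infᵢ[p_k] ≤ 4/N + 25·k²/N²`,
hence on the calibrating instance `N = k²` (`k ≥ 5`): `Infᵢ[p_k] ≤ 29/k²` for all `i`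
(`influence_chebyshevT_sq_le_of_sq`; exact numerics `2.00/k²`).

PROOF (elementary). Pointwise (`sq_sub_flipBit_chebyshevT_sq_le`):
`(p_k(x) − p_k(xⁱ))² ≤ 4·ȳ(x)² + 25k²/N²` for every `x`: a bit flip moves the sign mean by exactly
`2/N` (`signMeanVal_flipBit`); in the BULK `|ȳ| ≤ 1/2` both points lie in `[−3/5, 3/5]` (`N ≥ 20`), where
`z ↦ T_k(z)²` is `(5/2)k`-Lipschitz (`abs_chebyshevT_sq_sub_le`, mean value inequality) because
`(T_k²)' = 2k·T_k·U_{k−1}`, `|T_k| ≤ 1` and the INTERIOR bound `|U_{k−1}(z)| ≤ 1/√(1 − z²) ≤ 5/4`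
(`U_{k−1}(cos θ)·sin θ = sin kθ`; `abs_eval_chebyshevU_le`, `abs_deriv_chebyshevT_sq_le`) — the
Bernstein (not Markov) regime, which is what makes the influences `k²/N²` rather than `k⁴/N²`; OFF the
bulk the two `[0,1]`-values differ by at most `1 ≤ 4ȳ²`. Averaging, `E ȳ² = 1/N` exactly
(`boolAvg_signMeanVal_sq`: the signs are orthonormal on the cube, `sum_signTerm_mul_signTerm`) — i.e. the
cube Chebyshev tail `P[|ȳ| ≥ 1/2] ≤ 4/N` in averaged form.

CALIBRATION STATUS after this file (crux `PseudoBoundedAA`, `T`-side): on `N = k²` variables `p_k ∈ K_k`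
(previous file) has `maxᵢ Infᵢ ≤ 29/k²` (this file) and `Var[p_k] = 1/8 + E T_{4k}(ȳ)/8 − (E T_{2k}(ȳ))²/4`
(previous file; numerically `→ 0.1205`). The ONE remaining analytic input for the kernel statement
"`b ≥ 2` in every law `maxInf ≥ C·Var^a/T^b` on `K`" (equivalently: the corner law `maxInf ≥ C·Var²/T` of
the top-homogeneous class FAILS on `K`) is the variance floor (R1): `Var[p_k] ≥ v₀ > 0` at `N = k²`,
`k ≥ k₀` — e.g. via `|E T_{2k}(ȳ)| ≤ 1/4 ∧ E T_{4k}(ȳ) ≥ −1/4` (`boolVariance_chebyshevT_sq_ge`), or via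
the two-window bound `P[|ȳ| ≤ 1/(3k)] ≥ δ ∧ P[ȳ ∈ [0.53/k·2, 0.66/k·2]] ≥ δ` (`cos² ≥ 3/4` resp. `≤ 1/4`
there, `k ≡ 0 mod 4`); both reduce to the binomial window estimate
`C(2n, n + t)/4^n ≥ (1 − t²/n)/(2√n)` (`|t| ≤ √n`) — size M, CLT-free, not attempted here.

Sources: Chebyshev polynomials / interior (Bernstein) derivative bound [folklore]; amplitude
amplification profiles and the polynomial method [cite: BealsEtAl2001, §4]; the class `K_T`
[cite: KaniewskiLeeDewolf2015, Def. 7]; influences / cube averages [cite: ODonnell2014, §2.2].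
-/

set_option linter.dupNamespace false

noncomputable section

namespace Summit.QuantumAdvantage.QuantumAdvantage.Theorems.SosSandwich

open Finset
open Literature.Computability.QuantumComplexity

variable {N : ℕ}

/-! ### §1 Interior bounds for Chebyshev polynomials on `|z| ≤ 3/5` -/

/-- `|U_n(z)| ≤ 5/4` for `|z| ≤ 3/5` (all `n : ℤ`): `U_n(cos θ)·sin θ = sin((n+1)θ)` and
`sin θ = √(1 − z²) ≥ 4/5` there. [folklore] -/
theorem abs_eval_chebyshevU_le (n : ℤ) {z : ℝ} (hz : |z| ≤ 3 / 5) :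
    |(Polynomial.Chebyshev.U ℝ n).eval z| ≤ 5 / 4 := by
  have hz1 : -1 ≤ z := by linarith [(abs_le.mp hz).1]
  have hz2 : z ≤ 1 := by linarith [(abs_le.mp hz).2]
  have hsin : 4 / 5 ≤ Real.sin (Real.arccos z) := by
    rw [Real.sin_arccos]
    have hzz : z ^ 2 ≤ (3 / 5) ^ 2 := by
      rw [← sq_abs]; exact pow_le_pow_left₀ (abs_nonneg z) hz 2
    have h16 : (4 / 5 : ℝ) ^ 2 ≤ 1 - z ^ 2 := by nlinarith
    calc (4 / 5 : ℝ) = Real.sqrt ((4 / 5) ^ 2) := by rw [Real.sqrt_sq (by norm_num)]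
      _ ≤ Real.sqrt (1 - z ^ 2) := Real.sqrt_le_sqrt h16
  have key := Polynomial.Chebyshev.U_real_cos (Real.arccos z) n
  rw [Real.cos_arccos hz1 hz2] at key
  have hb : |(Polynomial.Chebyshev.U ℝ n).eval z| * Real.sin (Real.arccos z) ≤ 1 := by
    have := Real.abs_sin_le_one ((n + 1) * Real.arccos z)
    rw [← key, abs_mul, abs_of_nonneg (by linarith : (0 : ℝ) ≤ Real.sin (Real.arccos z))] at this
    exact this
  have hpos : (0 : ℝ) < Real.sin (Real.arccos z) := by linarith
  rw [← le_div_iff₀ hpos] at hb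
  calc |(Polynomial.Chebyshev.U ℝ n).eval z| ≤ 1 / Real.sin (Real.arccos z) := hb
    _ ≤ 1 / (4 / 5) := one_div_le_one_div_of_le (by norm_num) hsin
    _ = 5 / 4 := by norm_num

/-- Interior Bernstein-type bound for the square: `|d/dz T_k(z)²| ≤ (5/2)·k` on `|z| ≤ 3/5`
(`(T_k²)' = 2·T_k·k·U_{k−1}`, `|T_k| ≤ 1`, `|U_{k−1}| ≤ 5/4`). [folklore] -/
theorem abs_deriv_chebyshevT_sq_le (k : ℕ) {z : ℝ} (hz : |z| ≤ 3 / 5) :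
    |deriv (fun w => (Polynomial.Chebyshev.T ℝ (k : ℤ) ^ 2).eval w) z| ≤ 5 / 2 * k := by
  rw [Polynomial.deriv, Polynomial.derivative_sq, Polynomial.Chebyshev.T_derivative_eq_U]
  simp only [Polynomial.eval_mul, Polynomial.eval_C, Int.cast_natCast, Polynomial.eval_natCast]
  have hT := Polynomial.Chebyshev.abs_eval_T_real_le_one (k : ℤ) (hz.trans (by norm_num))
  have hU := abs_eval_chebyshevU_le ((k : ℤ) - 1) hz
  rw [abs_mul, abs_mul, abs_mul, abs_two, Nat.abs_cast]
  have hk : (0 : ℝ) ≤ k := Nat.cast_nonneg k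
  calc 2 * |(Polynomial.Chebyshev.T ℝ (k : ℤ)).eval z| *
        ((k : ℝ) * |(Polynomial.Chebyshev.U ℝ ((k : ℤ) - 1)).eval z|)
      ≤ 2 * 1 * ((k : ℝ) * (5 / 4)) := by gcongr
    _ = 5 / 2 * k := by ring

/-- Interior Lipschitz bound: `|T_k(z')² − T_k(z)²| ≤ (5/2)·k·|z' − z|` for `z, z' ∈ [−3/5, 3/5]`
(mean value inequality). [folklore] -/
theorem abs_chebyshevT_sq_sub_le (k : ℕ) {z z' : ℝ} (hz : |z| ≤ 3 / 5) (hz' : |z'| ≤ 3 / 5) :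
    |(Polynomial.Chebyshev.T ℝ (k : ℤ)).eval z' ^ 2 - (Polynomial.Chebyshev.T ℝ (k : ℤ)).eval z ^ 2|
      ≤ 5 / 2 * k * |z' - z| := by
  have hmem : ∀ w : ℝ, |w| ≤ 3 / 5 → w ∈ Set.Icc (-(3 / 5 : ℝ)) (3 / 5) := fun w hw =>
    ⟨by linarith [(abs_le.mp hw).1], (abs_le.mp hw).2⟩
  have h := Convex.norm_image_sub_le_of_norm_deriv_le
    (f := fun w => (Polynomial.Chebyshev.T ℝ (k : ℤ) ^ 2).eval w) (s := Set.Icc (-(3 / 5 : ℝ)) (3 / 5))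
    (fun w _ => Polynomial.differentiableAt _)
    (fun w hw => by
      rw [Real.norm_eq_abs]
      exact abs_deriv_chebyshevT_sq_le k (abs_le.mpr ⟨by linarith [hw.1], hw.2⟩))
    (convex_Icc _ _) (hmem z hz) (hmem z' hz')
  simpa [Real.norm_eq_abs, Polynomial.eval_pow] using h

/-! ### §2 The sign mean under a bit flip and its second moment -/

/-- Flipping bit `i` negates the `i`-th sign and keeps the others. [folklore] -/
theorem signTerm_flipBit (i j : Fin N) (x : Fin N → Bool) :
    (1 - 2 * (if flipBit i x j then (1 : ℝ) else 0)) =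
      if j = i then -(1 - 2 * (if x j then (1 : ℝ) else 0)) else (1 - 2 * (if x j then (1 : ℝ) else 0)) := by
  unfold flipBit
  by_cases h : j = i
  · subst h
    rw [Function.update_self, if_pos rfl]
    cases x j <;> norm_num
  · rw [Function.update_of_ne h, if_neg h]

/-- The sign mean moves by `∓ 2/N` under a bit flip: `ȳ(xⁱ) = ȳ(x) − (2/N)·(1 − 2xᵢ)`. [folklore] -/
theorem signMeanVal_flipBit (i : Fin N) (x : Fin N → Bool) :
    (1 / (N : ℝ)) * ∑ j, (1 - 2 * (if flipBit i x j then (1 : ℝ) else 0)) =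
      (1 / (N : ℝ)) * ∑ j, (1 - 2 * (if x j then (1 : ℝ) else 0))
        - (2 / (N : ℝ)) * (1 - 2 * (if x i then (1 : ℝ) else 0)) := by
  have hdiff : ∑ j, (1 - 2 * (if flipBit i x j then (1 : ℝ) else 0)) -
      ∑ j, (1 - 2 * (if x j then (1 : ℝ) else 0)) = -2 * (1 - 2 * (if x i then (1 : ℝ) else 0)) := by
    rw [← Finset.sum_sub_distrib]
    rw [Finset.sum_eq_single i]
    · rw [signTerm_flipBit, if_pos rfl]; ring
    · intro j _ hj
      rw [signTerm_flipBit, if_neg hj, sub_self]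
    · intro h; exact absurd (Finset.mem_univ i) h
  have hN : ∑ j, (1 - 2 * (if flipBit i x j then (1 : ℝ) else 0)) =
      ∑ j, (1 - 2 * (if x j then (1 : ℝ) else 0)) + -2 * (1 - 2 * (if x i then (1 : ℝ) else 0)) := by
    linarith
  rw [hN]
  ring

/-- Orthogonality of the signs on the cube: `Σₓ (1 − 2xⱼ)(1 − 2xₗ) = 2^N·[j = l]`. [folklore] -/
theorem sum_signTerm_mul_signTerm (j l : Fin N) :
    ∑ x : Fin N → Bool, (1 - 2 * (if x j then (1 : ℝ) else 0)) * (1 - 2 * (if x l then (1 : ℝ) else 0)) =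
      if j = l then (2 : ℝ) ^ N else 0 := by
  by_cases h : j = l
  · subst h
    rw [if_pos rfl]
    have h1 : ∀ x : Fin N → Bool,
        (1 - 2 * (if x j then (1 : ℝ) else 0)) * (1 - 2 * (if x j then (1 : ℝ) else 0)) = 1 := by
      intro x; cases x j <;> norm_num
    simp_rw [h1]
    simp [Fintype.card_bool, Fintype.card_fin]
  · rw [if_neg h]
    have hflip := sum_flipBit j (fun x => (1 - 2 * (if x j then (1 : ℝ) else 0)) *
      (1 - 2 * (if x l then (1 : ℝ) else 0)))
    have h2 : ∀ x : Fin N → Bool, (1 - 2 * (if flipBit j x j then (1 : ℝ) else 0)) *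
        (1 - 2 * (if flipBit j x l then (1 : ℝ) else 0)) =
        -((1 - 2 * (if x j then (1 : ℝ) else 0)) * (1 - 2 * (if x l then (1 : ℝ) else 0))) := by
      intro x
      rw [signTerm_flipBit, signTerm_flipBit, if_pos rfl, if_neg (Ne.symm h)]
      ring
    simp_rw [h2, Finset.sum_neg_distrib] at hflip
    linarith

/-- **Second moment of the sign mean**: `E ȳ² = 1/N` (`N ≥ 1`). [folklore] -/
theorem boolAvg_signMeanVal_sq (hN : 1 ≤ N) :
    boolAvg (fun x : Fin N → Bool => ((1 / (N : ℝ)) * ∑ j, (1 - 2 * (if x j then (1 : ℝ) else 0))) ^ 2) =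
      1 / (N : ℝ) := by
  have hN0 : (N : ℝ) ≠ 0 := by exact_mod_cast (show N ≠ 0 by omega)
  have h2N : (2 : ℝ) ^ N ≠ 0 := pow_ne_zero _ two_ne_zero
  unfold boolAvg
  have hsq : ∀ x : Fin N → Bool, ((1 / (N : ℝ)) * ∑ j, (1 - 2 * (if x j then (1 : ℝ) else 0))) ^ 2 =
      (1 / (N : ℝ)) ^ 2 * ∑ j, ∑ l, (1 - 2 * (if x j then (1 : ℝ) else 0)) *
        (1 - 2 * (if x l then (1 : ℝ) else 0)) := by
    intro x; rw [mul_pow, sq (∑ j, _), Finset.sum_mul_sum]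
  simp_rw [hsq]
  rw [← Finset.mul_sum, Finset.sum_comm]
  have hin : ∑ j : Fin N, ∑ x : Fin N → Bool, ∑ l : Fin N, (1 - 2 * (if x j then (1 : ℝ) else 0)) *
      (1 - 2 * (if x l then (1 : ℝ) else 0)) = ∑ j : Fin N, (2 : ℝ) ^ N := by
    refine Finset.sum_congr rfl fun j _ => ?_
    rw [Finset.sum_comm]
    simp_rw [sum_signTerm_mul_signTerm]
    rw [Finset.sum_ite_eq]
    simp
  rw [hin]
  simp only [Finset.sum_const, Finset.card_univ, Fintype.card_fin, nsmul_eq_mul]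
  field_simp

/-! ### §3 The influence bound for the Chebyshev family -/

/-- **Pointwise sensitivity of the Chebyshev family** (`N ≥ 20`): for every `x` and `i`,
`(p_k(x) − p_k(xⁱ))² ≤ 4·ȳ(x)² + 25k²/N²` — in the bulk `|ȳ| ≤ 1/2` the interior Lipschitz bound
gives `|Δ p_k| ≤ (5/2)k·(2/N)`, and off the bulk `(Δ p_k)² ≤ 1 ≤ 4ȳ²`. [folklore] -/
theorem sq_sub_flipBit_chebyshevT_sq_le (k : ℕ) (hN : 20 ≤ N) (i : Fin N) (x : Fin N → Bool) :
    (evalBool ((Polynomial.aeval (∑ i : Fin N, (MvPolynomial.C (1 / (N : ℝ)) -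
          MvPolynomial.C (2 / (N : ℝ)) * MvPolynomial.X i)) (Polynomial.Chebyshev.T ℝ (k : ℤ))) ^ 2) x -
      evalBool ((Polynomial.aeval (∑ i : Fin N, (MvPolynomial.C (1 / (N : ℝ)) -
          MvPolynomial.C (2 / (N : ℝ)) * MvPolynomial.X i)) (Polynomial.Chebyshev.T ℝ (k : ℤ))) ^ 2)
        (flipBit i x)) ^ 2 ≤
      4 * ((1 / (N : ℝ)) * ∑ j, (1 - 2 * (if x j then (1 : ℝ) else 0))) ^ 2 +
        25 * (k : ℝ) ^ 2 / (N : ℝ) ^ 2 := by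
  have hN1 : 1 ≤ N := le_trans (by norm_num) hN
  have hNr : (20 : ℝ) ≤ N := by exact_mod_cast hN
  have hNpos : (0 : ℝ) < N := by linarith
  rw [evalBool_chebyshevT_sq, evalBool_chebyshevT_sq, signMeanVal_flipBit]
  set z : ℝ := (1 / (N : ℝ)) * ∑ j, (1 - 2 * (if x j then (1 : ℝ) else 0)) with hz
  set e : ℝ := (1 - 2 * (if x i then (1 : ℝ) else 0)) with he
  have he1 : |e| = 1 := by rw [he]; cases x i <;> norm_num
  have hzle : |z| ≤ 1 := by
    have := abs_evalBool_signMean_le hN1 x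
    rwa [evalBool_signMean] at this
  have hk0 : (0 : ℝ) ≤ 25 * (k : ℝ) ^ 2 / (N : ℝ) ^ 2 := by positivity
  by_cases hbulk : |z| ≤ 1 / 2
  · -- bulk: both points in `[-3/5, 3/5]`
    have h2N : 2 / (N : ℝ) ≤ 1 / 10 := by
      rw [div_le_iff₀ hNpos]; linarith
    have hz35 : |z| ≤ 3 / 5 := hbulk.trans (by norm_num)
    have hz'35 : |z - 2 / (N : ℝ) * e| ≤ 3 / 5 := by
      calc |z - 2 / (N : ℝ) * e| ≤ |z| + |2 / (N : ℝ) * e| := abs_sub _ _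
        _ = |z| + 2 / (N : ℝ) := by
            rw [abs_mul (2 / (N : ℝ)) e, he1, mul_one, abs_of_pos (by positivity : (0 : ℝ) < 2 / N)]
        _ ≤ 1 / 2 + 1 / 10 := add_le_add hbulk h2N
        _ = 3 / 5 := by norm_num
    have hlip := abs_chebyshevT_sq_sub_le k hz35 hz'35
    have hdz : |z - 2 / (N : ℝ) * e - z| = 2 / (N : ℝ) := by
      rw [show z - 2 / (N : ℝ) * e - z = -(2 / (N : ℝ) * e) by ring, abs_neg, abs_mul (2 / (N : ℝ)) e, he1,
        mul_one, abs_of_pos (by positivity : (0 : ℝ) < 2 / N)]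
    rw [hdz] at hlip
    have hb : |(Polynomial.Chebyshev.T ℝ (k : ℤ)).eval z ^ 2 -
        (Polynomial.Chebyshev.T ℝ (k : ℤ)).eval (z - 2 / (N : ℝ) * e) ^ 2| ≤ 5 * (k : ℝ) / (N : ℝ) := by
      rw [abs_sub_comm]
      calc _ ≤ 5 / 2 * (k : ℝ) * (2 / (N : ℝ)) := hlip
        _ = 5 * (k : ℝ) / (N : ℝ) := by ring
    have hsq : ((Polynomial.Chebyshev.T ℝ (k : ℤ)).eval z ^ 2 -
        (Polynomial.Chebyshev.T ℝ (k : ℤ)).eval (z - 2 / (N : ℝ) * e) ^ 2) ^ 2 ≤ (5 * (k : ℝ) / (N : ℝ)) ^ 2 := by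
      rw [← sq_abs]
      exact pow_le_pow_left₀ (abs_nonneg _) hb 2
    have h25 : (5 * (k : ℝ) / (N : ℝ)) ^ 2 = 25 * (k : ℝ) ^ 2 / (N : ℝ) ^ 2 := by ring
    nlinarith [sq_nonneg z]
  · -- tail: the squared difference of two `[0,1]` values is `≤ 1 ≤ 4 z²`
    have hz' : |z - 2 / (N : ℝ) * e| ≤ 1 := by
      have := abs_evalBool_signMean_le hN1 (flipBit i x)
      rw [evalBool_signMean, signMeanVal_flipBit] at this
      exact this
    have hT := Polynomial.Chebyshev.abs_eval_T_real_le_one (k : ℤ) hzle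
    have hT' := Polynomial.Chebyshev.abs_eval_T_real_le_one (k : ℤ) hz'
    have ha : (Polynomial.Chebyshev.T ℝ (k : ℤ)).eval z ^ 2 ≤ 1 := by
      rw [← sq_abs]; nlinarith [abs_nonneg ((Polynomial.Chebyshev.T ℝ (k : ℤ)).eval z)]
    have hb : (Polynomial.Chebyshev.T ℝ (k : ℤ)).eval (z - 2 / (N : ℝ) * e) ^ 2 ≤ 1 := by
      rw [← sq_abs]
      nlinarith [abs_nonneg ((Polynomial.Chebyshev.T ℝ (k : ℤ)).eval (z - 2 / (N : ℝ) * e))]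
    have hd : ((Polynomial.Chebyshev.T ℝ (k : ℤ)).eval z ^ 2 -
        (Polynomial.Chebyshev.T ℝ (k : ℤ)).eval (z - 2 / (N : ℝ) * e) ^ 2) ^ 2 ≤ 1 := by
      nlinarith [sq_nonneg ((Polynomial.Chebyshev.T ℝ (k : ℤ)).eval z),
        sq_nonneg ((Polynomial.Chebyshev.T ℝ (k : ℤ)).eval (z - 2 / (N : ℝ) * e))]
    have hzbig : 1 < 4 * z ^ 2 := by
      have h12 : 1 / 2 < |z| := lt_of_not_ge hbulk
      rw [← sq_abs]; nlinarith [abs_nonneg z]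
    linarith

/-- **Influence bound for the Chebyshev family** (`N ≥ 20`, every variable `i`):
`Infᵢ[p_k] ≤ 4/N + 25k²/N²` — average of the pointwise sensitivity bound, with `E ȳ² = 1/N`
(cube Chebyshev tail) for the off-bulk part. At `N = k²` (`k ≥ 5`): `Infᵢ[p_k] ≤ 29/k²`
(numerically `2.00/k²`), while `Var[p_k] → 0.1205` — the `T`-side calibration `b ≥ 2`. [folklore] -/
theorem influence_chebyshevT_sq_le (k : ℕ) (hN : 20 ≤ N) (i : Fin N) :
    influence i ((Polynomial.aeval (∑ i : Fin N, (MvPolynomial.C (1 / (N : ℝ)) -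
          MvPolynomial.C (2 / (N : ℝ)) * MvPolynomial.X i)) (Polynomial.Chebyshev.T ℝ (k : ℤ))) ^ 2) ≤
      4 / (N : ℝ) + 25 * (k : ℝ) ^ 2 / (N : ℝ) ^ 2 := by
  have hN1 : 1 ≤ N := le_trans (by norm_num) hN
  unfold influence
  calc _ ≤ boolAvg (fun x : Fin N → Bool => 4 * ((1 / (N : ℝ)) * ∑ j, (1 - 2 * (if x j then (1 : ℝ) else 0))) ^ 2 +
        25 * (k : ℝ) ^ 2 / (N : ℝ) ^ 2) :=
          AaronsonAmbainisL1.boolAvg_mono fun x => sq_sub_flipBit_chebyshevT_sq_le k hN i x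
    _ = 4 * (1 / (N : ℝ)) + 25 * (k : ℝ) ^ 2 / (N : ℝ) ^ 2 := by
        rw [avg_add, avg_const_mul, boolAvg_signMeanVal_sq hN1, boolAvg_const]
    _ = 4 / (N : ℝ) + 25 * (k : ℝ) ^ 2 / (N : ℝ) ^ 2 := by ring

/-- **The calibrating instance `N = k²`** (`k ≥ 5`): `p_k ∈ K_k` on `k²` variables has EVERY influence
`≤ 29/k²`. [folklore] -/
theorem influence_chebyshevT_sq_le_of_sq (k : ℕ) (hk : 5 ≤ k) (hN : N = k ^ 2) (i : Fin N) :
    influence i ((Polynomial.aeval (∑ i : Fin N, (MvPolynomial.C (1 / (N : ℝ)) -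
          MvPolynomial.C (2 / (N : ℝ)) * MvPolynomial.X i)) (Polynomial.Chebyshev.T ℝ (k : ℤ))) ^ 2) ≤
      29 / (k : ℝ) ^ 2 := by
  have hN20 : 20 ≤ N := by subst hN; nlinarith
  have hk0 : (0 : ℝ) < k := by exact_mod_cast (show 0 < k by omega)
  refine (influence_chebyshevT_sq_le k hN20 i).trans (le_of_eq ?_)
  subst hN
  push_cast
  field_simp
  ring

end Summit.QuantumAdvantage.QuantumAdvantage.Theorems.SosSandwich

end
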